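import Summits.HodgeConjecture.CorCM.IrreducibleOddWeightsCoreTowerFamilies
import Summits.HodgeConjecture.CorCM.IrreducibleOddWeightsCoreTowerCMFields
import Summits.HodgeConjecture.CorCM.IrreducibleOddWeightsCanonicalPivotFamiliesCMFields
import HarnessLib

/-!
# Core tower, VI: FAMILIES of CM fields — `Σ_i dim Hg(A_i) − dim Hg(∏_i A_i)` computed on Galois fields containing the
# TRACES `K_i ∩ L_{≠i}`, and the type-free criterion this yields

COR-CM (cell `pub-hodgecm2`, binder seat `b16` gen 67, count-neutral claim CORE TOWER, file A6 — CM fields; theorems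
only, no definition, no named fact, no `sorry`).  NEW as stated, hence under `Summits/`.  HONEST FRAMING: exact,
hypothesis-free formulas and sufficient criteria for `Hg(∏_i A_i) = ∏_i Hg(A_i)` (finitely many abelian varieties with
complex multiplication by arbitrary CM fields); no Hodge class is claimed algebraic beyond the tree's nondegenerate case;
`HC_CM` is neither used nor asserted.

SETTING (gen 65 C5 `IrreducibleOddWeightsCanonicalPivotFamiliesCMFields`, A5 `IrreducibleOddWeightsCoreTowerFamilies`).
CM fields `K_i` (`i ∈ I` finite), types `Φ_i`, `A_i ⊨ (K_i; Φ_i)`, `L_i` the Galois closure of `K_i` in `ℂ`,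
`L_{≠j} = ⨆_{i≠j} L_i`.  C5: **`Σ_i dim Hg(A_i) − dim Hg(∏_i A_i) = Σ_j dim F_j − dim Σ_j F_j`** with `F_j` spanned by the
matrix coefficients of slot `j` summed over the classes of embeddings of `K_j` AGREEING ON THE TRACE `K_j ∩ L_{≠j}`.  HERE
(level two of the tower): let `T_j` be ANY number fields whose Galois closures `L_{T_j}` contain, for every `i ≠ j`, the
traces `a(K_i) ∩ L_{≠i}` of all embeddings `a` of `K_i` (canonically: `L_{T_j}` = the compositum over `i ≠ j` of the Galois
closures of the trace fields `K_i ∩ L_{≠i}` — a subfield of `L_{≠j}`, in general strictly smaller).  Then: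

* §1 `forall_rel_mem_span_traceSum_of_traces_le` — the level `(Aut(ℂ/L_{T_j}))_j` is ABSORBED: every component `c_j` of a
  relation `Σ_i c_i = 0` among matrix coefficients lies in `F_j^{T_j}`, the span of the matrix coefficients of slot `j`
  summed over the classes of embeddings agreeing on the trace `a⁻¹(L_{T_j})` (A5's family step from C4's level: an
  automorphism fixing `L_{T_j}` moves every embedding of every `K_i`, `i ≠ j`, inside its `Aut(ℂ/L_{≠i})`-class).
* §2 **`sum_cmTypeRank_add_one_add_finrank_iSup_eq_of_traces_le`** —
  **`Σ_i dim Hg(A_i) − dim Hg(∏_i A_i) = Σ_j dim F_j^{T_j} − dim Σ_j F_j^{T_j}`** for EVERY family of types; additive iff the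
  `F_j^{T_j}` are independent (`cmFamilyRank_add_card_eq_iff_iSupIndep_of_traces_le`).
* §3 **TYPE-FREE CRITERION** (`cmFamilyRank_add_card_eq_of_traces_le_of_forall_ne_conj_apply_eq`): if for every slot `j`
  except possibly one the trace of `L_{T_j}` on `K_j` is REAL along every embedding, then **`Hg(∏_i A_i) = ∏_i Hg(A_i)` for
  ALL CM types**, the family is nondegenerate iff every member is, no product `(⨁ A_{π₁}) × (⨁ A_{π₂})` with disjoint slot
  maps carries a mixed Hodge class, and for nondegenerate types every `∏_i A_i^{k_i}` satisfies the Hodge conjecture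
  (tree's Pohlmann–Gordon theorem).  C5 is the case `L_{T_j} = L_{≠j}`.

## References

* [Gordon1999HodgeAVSurvey] B. B. Gordon, *A survey of the Hodge conjecture for abelian varieties*, §3 Theorem (proof),
  7.5–7.7, 10.10.
* [Deligne1982HodgeCycles] P. Deligne, *Hodge cycles on abelian varieties*, LNM 900 (1982), I.5 (p. 62).
* [MoonenZarhin1999LowDim] B. Moonen, Yu. Zarhin, Math. Ann. 315 (1999), Thm. (0.2), §3 (3.1).
* [Lang2002] S. Lang, *Algebra*, 3rd ed., VI §1 Thm. 1.1, Cor. 1.6, Thm. 1.14 and V §2 Thm. 2.8.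
-/

set_option autoImplicit false

noncomputable section

open scoped BigOperators Classical
open CategoryTheory CategoryTheory.Limits NumberField Module IntermediateField

namespace Summit.HodgeConjecture.CorCM

open Literature.NumberTheory.ComplexMultiplication Literature.AlgebraicGeometry.Pohlmann1968
open Literature.AlgebraicGeometry.Motives (AbelianVariety CMType)
open Literature.AlgebraicGeometry.Motives.AbelianVariety
open Literature.AlgebraicGeometry.HodgeTheory
open Literature.AlgebraicGeometry.ComplexMultiplication (IsCMTypeRealisation)

/-! ### §1 The level of the traces is absorbed -/

section Absorb

variable {I : Type} [Fintype I] {K : I → Type} [∀ i, Field (K i)] [∀ i, NumberField (K i)]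
  {T : I → Type} [∀ j, Field (T j)] [∀ j, NumberField (T j)]

/-- **THE LEVEL OF THE TRACES IS ABSORBED.**  If `L_{T_j} ⊇ a(K_i) ∩ L_{≠i}` for all `i ≠ j` and all `a`, then every
component `c_j` of a relation `Σ_i c_i = 0` (`c_i ∈ MC_i`) lies in the span `F_j^{T_j}` of the matrix coefficients of
slot `j` summed over the `Aut(ℂ/L_{T_j})`-classes (base `⊥`, C4's step, then A5's step: an automorphism fixing `L_{T_j}`
fixes every trace `a(K_i) ∩ L_{≠i}`, hence moves `a` inside its `Aut(ℂ/L_{≠i})`-class — C5's trace lemma).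
[cite: Gordon1999HodgeAVSurvey, §3 Theorem (proof)] [cite: Lang2002, VI §1 Thm. 1.1, Cor. 1.6 and Thm. 1.14] -/
theorem forall_rel_mem_span_traceSum_of_traces_le (Φ : ∀ i, CMType (K i))
    (hT : ∀ j i : I, i ≠ j → ∀ (a : K i →+* ℂ) (k : K i),
      a k ∈ (⨆ l : {l : I // l ≠ i}, normalClosure ℚ (K l.1) ℂ) → a k ∈ normalClosure ℚ (T j) ℂ)
    (c : I → (ℂ ≃+* ℂ) → ℚ)
    (hc : ∀ i, c i ∈ Submodule.span ℚ (Set.range fun x : K i →+* ℂ => fun g : ℂ ≃+* ℂ => antiVec (Φ i).1 g x))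
    (hsum : ∑ i, c i = 0) (j : I) :
    c j ∈ Submodule.span ℚ (Set.range fun a : K j →+* ℂ => fun g : ℂ ≃+* ℂ =>
      ∑ t ∈ Finset.univ.filter (fun t : K j →+* ℂ =>
        ∃ n ∈ (MulAction.toPermHom (ℂ ≃+* ℂ) (T j →+* ℂ)).ker, n • a = t), antiVec (Φ j).1 g t) := by
  -- level one (C4): `N¹_j = ⋂_{i≠j} PW_i`, reached from `⊥` by A5's step
  have h1 : ∀ c : I → (ℂ ≃+* ℂ) → ℚ,
      (∀ i, c i ∈ Submodule.span ℚ (Set.range fun x : K i →+* ℂ => fun g : ℂ ≃+* ℂ => antiVec (Φ i).1 g x)) →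
        ∑ i, c i = 0 → ∀ j, c j ∈ Submodule.span ℚ (Set.range fun a : K j →+* ℂ => fun g : ℂ ≃+* ℂ =>
          ∑ t ∈ Finset.univ.filter (fun t : K j →+* ℂ =>
            ∃ n ∈ (⨅ (i : I) (_ : i ≠ j), (MulAction.toPermHom (ℂ ≃+* ℂ) (K i →+* ℂ)).ker), n • a = t),
              antiVec (Φ j).1 g t) :=
    IrrOdd.forall_rel_mem_span_orbitSum_of_absorbed (G := ℂ ≃+* ℂ) (E := fun i => K i →+* ℂ) (fun i => (Φ i).1)
      (fun _ => ⊥) (fun j => ⨅ (i : I) (_ : i ≠ j), (MulAction.toPermHom (ℂ ≃+* ℂ) (K i →+* ℂ)).ker)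
      (fun _ => inferInstance)
      (fun c hc hsum j => IrrOdd.forall_rel_mem_span_orbitSum_bot (G := ℂ ≃+* ℂ) (E := fun i => K i →+* ℂ)
        (fun i => (Φ i).1) c hc j)
      (fun j n hn => Subgroup.subset_closure (Or.inr fun i hi x =>
        ⟨1, (⊥ : Subgroup (ℂ ≃+* ℂ)).one_mem, by
          rw [one_smul]
          exact ((IrrOdd.mem_iInf_ker_toPermHom_iff (G := ℂ ≃+* ℂ) (E := fun i => K i →+* ℂ) j n).1 hn i hi x).symm⟩))
  -- level two: `N²_j = Aut(ℂ/L_{T_j})` moves every `a : K_i → ℂ`, `i ≠ j`, inside its `N¹_i`-class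
  haveI : ∀ j : I, (⨅ (i : I) (_ : i ≠ j), (MulAction.toPermHom (ℂ ≃+* ℂ) (K i →+* ℂ)).ker).Normal :=
    fun j => Subgroup.normal_iInf_normal fun i => Subgroup.normal_iInf_normal fun _ => inferInstance
  exact IrrOdd.forall_rel_mem_span_orbitSum_of_absorbed (G := ℂ ≃+* ℂ) (E := fun i => K i →+* ℂ) (fun i => (Φ i).1)
    (fun j => ⨅ (i : I) (_ : i ≠ j), (MulAction.toPermHom (ℂ ≃+* ℂ) (K i →+* ℂ)).ker)
    (fun j => (MulAction.toPermHom (ℂ ≃+* ℂ) (T j →+* ℂ)).ker) (fun j => inferInstance) h1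
    (fun j m hm => Subgroup.subset_closure (Or.inr fun i hi a => by
      have hm' := (IrrOdd.mem_ker_toPermHom_iff (G := ℂ ≃+* ℂ) (X := T j →+* ℂ) m).1 hm
      obtain ⟨n, hn, hna⟩ := (exists_stabOthers_smul_eq_iff_forall_apply_eq i a (m • a)).2 fun k hk => by
        rw [ringEquiv_smul_apply]
        exact (forall_smul_eq_iff_forall_mem_normalClosure_aux m).1 hm' _ (hT j i hi a k hk)
      exact ⟨n, (IrrOdd.mem_iInf_ker_toPermHom_iff (G := ℂ ≃+* ℂ) (E := fun i => K i →+* ℂ) i n).2 hn, hna⟩))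
    c hc hsum j

omit [Fintype I] in
/-- The `Aut(ℂ/L_{T_j})`-class of `a`, as a finite set, is the class of embeddings agreeing with `a` on the trace
`a⁻¹(L_{T_j})`. [cite: Lang2002, VI §1 Thm. 1.1 and Cor. 1.6] -/
theorem filter_exists_mem_ker_smul_eq_eq_filter_trace (j : I) (a : K j →+* ℂ) :
    Finset.univ.filter (fun t : K j →+* ℂ =>
        ∃ n ∈ (MulAction.toPermHom (ℂ ≃+* ℂ) (T j →+* ℂ)).ker, n • a = t) =
      Finset.univ.filter (fun t : K j →+* ℂ => ∀ k : K j, a k ∈ normalClosure ℚ (T j) ℂ → t k = a k) := by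
  refine Finset.filter_congr fun t _ => ?_
  rw [← exists_stabAux_smul_eq_iff_forall_apply_eq (T := T j) a t]
  constructor
  · rintro ⟨n, hn, h⟩
    exact ⟨n, (IrrOdd.mem_ker_toPermHom_iff (G := ℂ ≃+* ℂ) (X := T j →+* ℂ) n).1 hn, h⟩
  · rintro ⟨n, hn, h⟩
    exact ⟨n, (IrrOdd.mem_ker_toPermHom_iff (G := ℂ ≃+* ℂ) (X := T j →+* ℂ) n).2 hn, h⟩

omit [Fintype I] in
/-- The orbit-sum span over `Aut(ℂ/L_{T_j})` is the trace-sum span (a `Submodule` equality for rewriting).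
[cite: Lang2002, VI §1 Thm. 1.1 and Cor. 1.6] -/
theorem span_kerOrbitSum_eq_span_traceSum (j : I) (Φj : CMType (K j)) :
    Submodule.span ℚ (Set.range fun a : K j →+* ℂ => fun g : ℂ ≃+* ℂ =>
        ∑ t ∈ Finset.univ.filter (fun t : K j →+* ℂ =>
          ∃ n ∈ (MulAction.toPermHom (ℂ ≃+* ℂ) (T j →+* ℂ)).ker, n • a = t), antiVec Φj.1 g t) =
      Submodule.span ℚ (Set.range fun a : K j →+* ℂ => fun g : ℂ ≃+* ℂ =>
        ∑ t ∈ Finset.univ.filter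
          (fun t : K j →+* ℂ => ∀ k : K j, a k ∈ normalClosure ℚ (T j) ℂ → t k = a k), antiVec Φj.1 g t) := by
  simp only [filter_exists_mem_ker_smul_eq_eq_filter_trace]

end Absorb

/-! ### §2 The exact family defect on the level of the traces -/

section Rank

variable {I : Type} [Fintype I] {K : I → Type} [∀ i, Field (K i)] [∀ i, NumberField (K i)] [∀ i, IsCMField (K i)]
  {T : I → Type} [∀ j, Field (T j)] [∀ j, NumberField (T j)]

/-- **THE EXACT FAMILY DEFECT ON THE LEVEL OF THE TRACES**: for ANY finite family of CM fields and types and any number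
fields `T_j` with `L_{T_j} ⊇ a(K_i) ∩ L_{≠i}` (`i ≠ j`, all `a`):
`Σ_i cmTypeRank Φ_i + 1 + dim ⨆_j F_j^{T_j} = cmFamilyRank Φ + |I| + Σ_j dim F_j^{T_j}`, i.e.
**`Σ_i dim Hg(A_i) − dim Hg(∏_i A_i) = Σ_j dim F_j^{T_j} − dim Σ_j F_j^{T_j}`**, `F_j^{T_j}` spanned by the matrix
coefficients of slot `j` summed over the classes of embeddings AGREEING ON THE TRACE `a⁻¹(L_{T_j})`.
[cite: Deligne1982HodgeCycles, I.5 (p. 62)] [cite: Gordon1999HodgeAVSurvey, §3 Theorem and 7.7] -/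
theorem sum_cmTypeRank_add_one_add_finrank_iSup_eq_of_traces_le [Nonempty I] (Φ : ∀ i, CMType (K i))
    (hT : ∀ j i : I, i ≠ j → ∀ (a : K i →+* ℂ) (k : K i),
      a k ∈ (⨆ l : {l : I // l ≠ i}, normalClosure ℚ (K l.1) ℂ) → a k ∈ normalClosure ℚ (T j) ℂ) :
    (∑ i, cmTypeRank (Φ i)) + 1 + Module.finrank ℚ (⨆ j, Submodule.span ℚ (Set.range fun a : K j →+* ℂ =>
        fun g : ℂ ≃+* ℂ => ∑ t ∈ Finset.univ.filter (fun t : K j →+* ℂ =>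
          ∀ k : K j, a k ∈ normalClosure ℚ (T j) ℂ → t k = a k), antiVec (Φ j).1 g t) :
            Submodule ℚ ((ℂ ≃+* ℂ) → ℚ)) =
      CMAlgebra.cmFamilyRank Φ + Fintype.card I +
        ∑ j, Module.finrank ℚ (Submodule.span ℚ (Set.range fun a : K j →+* ℂ => fun g : ℂ ≃+* ℂ =>
          ∑ t ∈ Finset.univ.filter (fun t : K j →+* ℂ =>
            ∀ k : K j, a k ∈ normalClosure ℚ (T j) ℂ → t k = a k), antiVec (Φ j).1 g t)) := by
  haveI : ∀ i, Nonempty (K i →+* ℂ) := fun i => inferInstance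
  have h := IrrOdd.sum_typeRank_add_one_add_finrank_iSup_eq_of_absorbed (G := ℂ ≃+* ℂ) (E := fun i => K i →+* ℂ)
    (Φ := fun i => (Φ i).1) (fun i => isCMTypeWith_conj (Φ i))
    (fun j => (MulAction.toPermHom (ℂ ≃+* ℂ) (T j →+* ℂ)).ker) (forall_rel_mem_span_traceSum_of_traces_le Φ hT)
  have e := fun j : I => span_kerOrbitSum_eq_span_traceSum (T := T) j (Φ j)
  have e2 : (∑ j, Module.finrank ℚ (Submodule.span ℚ (Set.range fun a : K j →+* ℂ => fun g : ℂ ≃+* ℂ =>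
      ∑ t ∈ Finset.univ.filter (fun t : K j →+* ℂ =>
        ∃ n ∈ (MulAction.toPermHom (ℂ ≃+* ℂ) (T j →+* ℂ)).ker, n • a = t), antiVec (Φ j).1 g t))) =
      ∑ j, Module.finrank ℚ (Submodule.span ℚ (Set.range fun a : K j →+* ℂ => fun g : ℂ ≃+* ℂ =>
        ∑ t ∈ Finset.univ.filter (fun t : K j →+* ℂ =>
          ∀ k : K j, a k ∈ normalClosure ℚ (T j) ℂ → t k = a k), antiVec (Φ j).1 g t)) :=
    Finset.sum_congr rfl fun j _ => by rw [e j]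
  rw [iSup_congr e, e2] at h
  exact h

/-- **`Hg(∏_i A_i) = ∏_i Hg(A_i)` IFF THE `F_j^{T_j}` ARE INDEPENDENT** (level of the traces).
[cite: Gordon1999HodgeAVSurvey, §3 Theorem and 7.5–7.7] -/
theorem cmFamilyRank_add_card_eq_iff_iSupIndep_of_traces_le [Nonempty I] (Φ : ∀ i, CMType (K i))
    (hT : ∀ j i : I, i ≠ j → ∀ (a : K i →+* ℂ) (k : K i),
      a k ∈ (⨆ l : {l : I // l ≠ i}, normalClosure ℚ (K l.1) ℂ) → a k ∈ normalClosure ℚ (T j) ℂ) :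
    CMAlgebra.cmFamilyRank Φ + Fintype.card I = (∑ i, cmTypeRank (Φ i)) + 1 ↔
      iSupIndep fun j => Submodule.span ℚ (Set.range fun a : K j →+* ℂ => fun g : ℂ ≃+* ℂ =>
        ∑ t ∈ Finset.univ.filter (fun t : K j →+* ℂ =>
          ∀ k : K j, a k ∈ normalClosure ℚ (T j) ℂ → t k = a k), antiVec (Φ j).1 g t) := by
  haveI : ∀ i, Nonempty (K i →+* ℂ) := fun i => inferInstance
  have h := IrrOdd.typeRank_sigmaType_add_card_eq_iff_iSupIndep_of_absorbed (G := ℂ ≃+* ℂ)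
    (E := fun i => K i →+* ℂ) (Φ := fun i => (Φ i).1) (fun i => isCMTypeWith_conj (Φ i))
    (fun j => (MulAction.toPermHom (ℂ ≃+* ℂ) (T j →+* ℂ)).ker) (forall_rel_mem_span_traceSum_of_traces_le Φ hT)
  have e : (fun j : I => Submodule.span ℚ (Set.range fun a : K j →+* ℂ => fun g : ℂ ≃+* ℂ =>
      ∑ t ∈ Finset.univ.filter (fun t : K j →+* ℂ =>
        ∃ n ∈ (MulAction.toPermHom (ℂ ≃+* ℂ) (T j →+* ℂ)).ker, n • a = t), antiVec (Φ j).1 g t)) =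
      fun j : I => Submodule.span ℚ (Set.range fun a : K j →+* ℂ => fun g : ℂ ≃+* ℂ =>
        ∑ t ∈ Finset.univ.filter (fun t : K j →+* ℂ =>
          ∀ k : K j, a k ∈ normalClosure ℚ (T j) ℂ → t k = a k), antiVec (Φ j).1 g t) :=
    funext fun j => span_kerOrbitSum_eq_span_traceSum (T := T) j (Φ j)
  rw [e] at h
  exact h

/-! ### §3 The type-free criterion and its Hodge side -/

/-- **REAL TRACES OF THE `L_{T_j}` FORCE `Hg(∏_i A_i) = ∏_i Hg(A_i)` FOR ALL TYPES**: if for every slot `j` except possibly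
`j₀` and every embedding `a` of `K_j` the elements of `a(K_j) ∩ L_{T_j}` are real, then
`cmFamilyRank Φ + |I| = Σ_i cmTypeRank Φ_i + 1` for EVERY family of CM types.  (C5 asked this of the larger traces
`a(K_j) ∩ L_{≠j}`.) [cite: Gordon1999HodgeAVSurvey, §3 Theorem (proof) and 7.5–7.7] [cite: MoonenZarhin1999LowDim, Thm. (0.2)] -/
theorem cmFamilyRank_add_card_eq_of_traces_le_of_forall_ne_conj_apply_eq [Nonempty I] (Φ : ∀ i, CMType (K i))
    (hT : ∀ j i : I, i ≠ j → ∀ (a : K i →+* ℂ) (k : K i),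
      a k ∈ (⨆ l : {l : I // l ≠ i}, normalClosure ℚ (K l.1) ℂ) → a k ∈ normalClosure ℚ (T j) ℂ)
    (j₀ : I) (hreal : ∀ j : I, j ≠ j₀ → ∀ (a : K j →+* ℂ) (k : K j),
      a k ∈ normalClosure ℚ (T j) ℂ → starRingEnd ℂ (a k) = a k) :
    CMAlgebra.cmFamilyRank Φ + Fintype.card I = (∑ i, cmTypeRank (Φ i)) + 1 := by
  haveI : ∀ i, Nonempty (K i →+* ℂ) := fun i => inferInstance
  exact IrrOdd.typeRank_sigmaType_add_card_eq_of_absorbed_of_forall_ne_rho_stable (G := ℂ ≃+* ℂ)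
    (E := fun i => K i →+* ℂ) (Φ := fun i => (Φ i).1) (fun i => isCMTypeWith_conj (Φ i))
    (fun j => (MulAction.toPermHom (ℂ ≃+* ℂ) (T j →+* ℂ)).ker) (forall_rel_mem_span_traceSum_of_traces_le Φ hT) j₀
    fun j hj a => by
      obtain ⟨n, hn, hna⟩ := exists_stabAux_smul_eq_conj_of_forall_conj_apply_eq (T := T j) a (hreal j hj a)
      exact ⟨n, (IrrOdd.mem_ker_toPermHom_iff (G := ℂ ≃+* ℂ) (X := T j →+* ℂ) n).2 hn, hna⟩

/-- **… then the family is nondegenerate iff every member is.** [cite: Gordon1999HodgeAVSurvey, 7.5–7.6.1] -/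
theorem isNondegenerateFamily_iff_forall_of_traces_le_of_forall_ne_conj_apply_eq [Nonempty I] (Φ : ∀ i, CMType (K i))
    (hT : ∀ j i : I, i ≠ j → ∀ (a : K i →+* ℂ) (k : K i),
      a k ∈ (⨆ l : {l : I // l ≠ i}, normalClosure ℚ (K l.1) ℂ) → a k ∈ normalClosure ℚ (T j) ℂ)
    (j₀ : I) (hreal : ∀ j : I, j ≠ j₀ → ∀ (a : K j →+* ℂ) (k : K j),
      a k ∈ normalClosure ℚ (T j) ℂ → starRingEnd ℂ (a k) = a k) :
    CMAlgebra.IsNondegenerateFamily Φ ↔ ∀ i, IsNondegenerate (Φ i) :=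
  isNondegenerateFamily_iff_forall_of_cmFamilyRank_add_card_eq Φ
    (cmFamilyRank_add_card_eq_of_traces_le_of_forall_ne_conj_apply_eq Φ hT j₀ hreal)

variable [DecidableEq I] {Φ : ∀ i, CMType (K i)} {A : I → AbelianVariety ℂ} {ιA : ∀ i, 𝓞 (K i) →+* End (A i)}
  {θ : ∀ i, K i →+* Module.End ℂ (complexBetti (A i).X 1)}

/-- **… and no product `(⨁_l A_{π₁ l}) × (⨁_l A_{π₂ l})` with disjoint slot maps carries a MIXED Hodge class**: every
rational Hodge class there is a `ℂ`-combination of exterior products, whatever the types.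
[cite: MoonenZarhin1999LowDim, §3 (3.1)] [cite: Gordon1999HodgeAVSurvey, 7.5–7.7] -/
theorem forall_hodgeClassesProductSpan_of_traces_le_of_forall_ne_conj_apply_eq [Nonempty I]
    (hT : ∀ j i : I, i ≠ j → ∀ (a : K i →+* ℂ) (k : K i),
      a k ∈ (⨆ l : {l : I // l ≠ i}, normalClosure ℚ (K l.1) ℂ) → a k ∈ normalClosure ℚ (T j) ℂ)
    (j₀ : I) (hreal : ∀ j : I, j ≠ j₀ → ∀ (a : K j →+* ℂ) (k : K j),
      a k ∈ normalClosure ℚ (T j) ℂ → starRingEnd ℂ (a k) = a k)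
    (hA : ∀ i, IsCMTypeRealisation (Φ i) (A i) (ιA i) (θ i)) (N₁ N₂ : ℕ) [NeZero N₁] [NeZero N₂] (π₁ : Fin N₁ → I)
    (π₂ : Fin N₂ → I) (hdisj : ∀ l₁ l₂, π₁ l₁ ≠ π₂ l₂) :
    HodgeClassesProductSpan (⨁ fun l => A (π₁ l)) (⨁ fun l => A (π₂ l)) :=
  (cmFamilyRank_add_card_eq_iff_forall_hodgeClassesProductSpan hA).1
    (cmFamilyRank_add_card_eq_of_traces_le_of_forall_ne_conj_apply_eq Φ hT j₀ hreal) N₁ N₂ π₁ π₂ hdisj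

omit [DecidableEq I] in
/-- **… and for NONDEGENERATE types every product `⨁_l A_{π l}` satisfies the Hodge conjecture, unconditionally** (the
family is nondegenerate; the tree's Pohlmann–Gordon theorem). [cite: Gordon1999HodgeAVSurvey, 10.10 and 7.5]
[cite: MoonenZarhin1999LowDim, Thm. (0.2)] -/
theorem hodgeConjectureFor_prod_of_traces_le_of_forall_ne_conj_apply_eq [Nonempty I]
    (hT : ∀ j i : I, i ≠ j → ∀ (a : K i →+* ℂ) (k : K i),
      a k ∈ (⨆ l : {l : I // l ≠ i}, normalClosure ℚ (K l.1) ℂ) → a k ∈ normalClosure ℚ (T j) ℂ)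
    (j₀ : I) (hreal : ∀ j : I, j ≠ j₀ → ∀ (a : K j →+* ℂ) (k : K j),
      a k ∈ normalClosure ℚ (T j) ℂ → starRingEnd ℂ (a k) = a k)
    (hnd : ∀ i, IsNondegenerate (Φ i)) (hA : ∀ i, IsCMTypeRealisation (Φ i) (A i) (ιA i) (θ i)) {N : ℕ}
    (π : Fin N → I) :
    HodgeConjectureFor (⨁ fun l : Fin N => A (π l)).dim (⨁ fun l : Fin N => A (π l)).X :=
  ((isNondegenerateFamily_iff_forall_of_traces_le_of_forall_ne_conj_apply_eq Φ hT j₀ hreal).2 hnd).hodgeConjectureFor_prod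
    hA π

end Rank

end Summit.HodgeConjecture.CorCM

end
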